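import Summits.CriticalPhenomena.PercolationContinuityZ3.Theorems.Transplant.SkelPhiCellsSmallMS
import Summits.CriticalPhenomena.PercolationContinuityZ3.Theorems.Transplant.KNCells2SchemeO
import HarnessLib

/-!
# N2 (frames-only node `SamePDropOfSkeletonFrm₁`, OPEN), Γ ROWS (a): THE VERTEX-LEVEL ROOMS OF THE STAGGERED SCHEME OF RECORD
# `cellGeomSG₂bS G ψ P w₀ Λ b₀` / `faceDataSGS G ψ P w₀ Λ` (hp-8 g40, SkelPhiCellsSmallMS / WeakGLevelsS) — the `PCells2S` twins of the (C)-column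
# readers of N1 (`SkelPhiNegReachRooms` C-R, `SkelPhiNegReachRoomsB` §3, `SkelPhiNegReachTargets` §2, `SkelPhiNegReachDeepB`), i.e. the GEOMETRY half
# of the habitat rows `hΩball / hreg / hlastM / hdeep` (and the footprint form of `hM0`) of p5-g15's `Skelφ.reachOblAtHNF_of_kgCorr`
# (SkelPhiCorridorKGResidue p346367) and `Skelφ.real_rim_le_corrO` (SkelPhiCorridorKGExcess), at the fresh habitat
# `Ω := Γ.Ewv α v e.2 ∪ FD.Hfull a' (tgt e) du` of a probe `e = (v, e.2)`, `x = tgt e`, `y = x + du`: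
* §1 PLANAR level-form rooms about the staggered centre (`PCells2S.mem_Q_of_levS`, `mem_Hfull_of_levS`, `mem_Q_union_Hfull_of_levS`,
  `Icc_unit_subset_Mb_add_of_levS` — the unit box of `z` inside the small ARRIVAL box `cenS (x+du) ± b₀` about the STAGGERED target centre,
  `cenS (x+du)∥ = cenS x∥ + 20 r∥ σ`, `cenS (x+du)⊥ = cenS x⊥ + σ c∥`), and `BtwNS_disjoint_Q_union_Hfull` (the incoming arm of record misses
  `Q x ∪ H_{x,du}` for `du ≠ rev e.2`) — the interface the K-G-prism numerics (p5-g15, (c)) target;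
* §2 `hreg`: `Skelφ.mem_Q_or_Hfull_of_mem_habΩS`, `mem_Q_union_Efar_of_mem_habΩS` (a habitat vertex with footprint in `Q x ∪ H_{x,du}` lies in
  `Q_α(x) ∪ E^far_{a'}(x,du)`, `StepsGeom.Hfull_subset`);
* §3 `hΩball`: `Skelφ.mem_Q_union_HfullSpanS` (WEAK steps + `Lip`: a vertex whose footprint has level in `[−5r∥ + 1, 22r∥ − 1]` and transverse
  margin `2r⊥ − 1` about `cenS x`, at depth `D` with `D + 1 ≤ Λ.rQ α x`, `D + 1 ≤ Λ.ρ a' x du ℓ`, lies in `Q_α(x) ∪ H^{a'}_{x,du}` — some neighbour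
  shares its window) and `Q_union_HfullSpan_subset_habΩS`;
* §4 `hM0` / `hlastM`: `footprint_mem_of_mem_MbS` (`v ∈ M_α(x) ⇒ ψ v ∈ cenS x ± b₀`, with the ball), `mem_Mb_of_mem_HfullS`, `mem_Mb_of_mem_habΩS`
  (a habitat vertex with footprint in `H_{x,du}` whose unit box lies in `cenS (x+du) ± b₀`, `b₀ ≤ 3r`, lies in `M_{a'}(x+du)`; depth room
  `Λ.ρ a' x du ℓ + 1 ≤ Λ.rM a' (x+du)`);
* §5 `hdeep` FROM VALIDITY: **`Skelφ.deep_of_valid₂OS`** — for a `Valid₂O` history of the ORIENTED lag-1 scheme `⟨cellGeomSG₂bS …, q, δc⟩`, every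
  explored vertex adjacent to the fresh world `Ω` lies in `B(w₀, R₀)` once `Λ.rC α v ≤ R₀` and `Λ.rB α v δ′ ≤ R₀` (`α = aOf₁O h e`): by
  `Valid₂O.cover` the explored region lies in the cells and stub zones (at the arrival anchors) of determined macro-vertices other than `x` and
  `x + du`; off the lineage (`u ≠ v`) those are ℓ^∞-gap-2 separated from the probe world of record `probeWorldNS v e.2 du ⊇ ψ(Ω)`
  (p3-g15's `PCells2S.Cell_sepInf_probeWorldNS` / `Zone_sepInf_probeWorldNS`, PlanarCells2SepInfS), so `Lip` forbids the edge; on the lineage the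
  window radii are `rC α v` / `rB α v δ′`.  (N1 read the same fact off the run invariant `RunInv₂.V_cases`, SkelPhiNegReachDeepB; the oriented
  scheme's validity predicate carries the cover, so no run is needed.)
The RADIUS rows (`R₀` against the corridor window, the consistency rows) and the WORLD rows `hWπ / hWpl` are stmt-g20's `SkelFrmBChoiceRooms` (b);
the run-frame numerics feeding §1 are p5-g15's (c).  Generic in `(P, Λ, b₀)`: at the scheme of record `NegB.ΓQ … = cellGeomSG₂bS …` every lemma
applies by `rfl`.
builds on p205010 (kernel theorem, internal audit signed; external expert review pending) — nothing in this file uses p205010; nothing here is a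
claim about the open node `SamePDropOfSkeletonFrm₁`.
Lane `prim-bschramm`, seat `prim-hp-8` (gen 40; Geom pen, lead g11 01:23:05Z (a)); helper file (`--supports stmt-CriticalPhenomena-4575 --as helper`).
[cite: KozmaNitzan2024, §4 pp. 25–27 (Q_v, M_v, E_{v,x}, H_{v,x}, (29), (31)), Lemma 12 (pp. 23–25), p. 30 (Step IV), p. 31] [cite: MartineauTassion2017, §4.3]
-/

noncomputable section

open scoped Classical

namespace Summit.CriticalPhenomena.PercolationContinuityZ3.Theorems

namespace Transplant

open Literature.Probability.Percolation Literature.Probability.LatticeModels SimpleGraph GadgetSystem Contour KNCells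
open Literature.Probability.Percolation.KozmaNitzan
open Literature.Probability.Percolation.KozmaNitzan.Cells (oth oth_ne sgOf sgOf_sign stepVec_apply_fst stepVec_apply_oth eq_oth_of_ne oth_oth)
open Literature.Barriers.CriticalPhenomena (graphBall graphBall_finite mem_graphBall_self graphBall_mono)
open BoxProdZ2 (ConcRadiiG mem_graphBall_succ_of_adj)
open PlanarSkeletonConc (mem_vspan_edgesIn_iff mem_vspan_edgesIn_of_adj)
open PCells (mem_psBox_iff)

/-! ## §1 Planar level-form rooms about the staggered centre -/

namespace PCells2S

variable (P : PCells2S) {y : Site 2} {du : MDir} {z : Site 2}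

/-- **`z ∈ Q_y`** from `−5r∥ ≤ lev ≤ 5r∥` (level along `du` about `cenS y`) and `|z⊥ − cenS y⊥| ≤ 5r⊥`. [cite: KozmaNitzan2024, §4 p. 26 (Q_v)] -/
theorem mem_Q_of_levS (h1 : -(5 * (P.r du.1 : ℤ)) ≤ PCells2S.lev P du y z) (h2 : PCells2S.lev P du y z ≤ 5 * (P.r du.1 : ℤ))
    (h3 : PCells2S.cenS P y (oth du.1) - 5 * (P.r (oth du.1) : ℤ) ≤ z (oth du.1))
    (h4 : z (oth du.1) ≤ PCells2S.cenS P y (oth du.1) + 5 * (P.r (oth du.1) : ℤ)) : z ∈ PCells2S.Q P y := by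
  rw [Q, mem_aboxS_iff]
  intro i
  push_cast
  by_cases hi : i = du.1
  · subst hi
    rw [lev_def] at h1 h2
    rcases sgOf_sign du with hs | hs <;> rw [hs] at h1 h2 <;> constructor <;> linarith
  · rw [eq_oth_of_ne hi]; exact ⟨h3, h4⟩

/-- **`z ∈ H_{y,du}`** from `5r∥ ≤ lev ≤ 22r∥` and `|z⊥ − cenS y⊥| ≤ 2r⊥`. [cite: KozmaNitzan2024, §4 p. 26 (H_{v,x})] -/
theorem mem_Hfull_of_levS (h1 : 5 * (P.r du.1 : ℤ) ≤ PCells2S.lev P du y z) (h2 : PCells2S.lev P du y z ≤ 22 * (P.r du.1 : ℤ))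
    (h3 : PCells2S.cenS P y (oth du.1) - 2 * (P.r (oth du.1) : ℤ) ≤ z (oth du.1))
    (h4 : z (oth du.1) ≤ PCells2S.cenS P y (oth du.1) + 2 * (P.r (oth du.1) : ℤ)) : z ∈ PCells2S.Hfull P y du := by
  rw [Hfull, mem_psBox_iff]
  rw [lev_def] at h1 h2
  exact ⟨⟨h1, h2⟩, h3, h4⟩

/-- **`z ∈ Q_y ∪ H_{y,du}`** from `−5r∥ ≤ lev ≤ 22r∥` and `|z⊥ − cenS y⊥| ≤ 2r⊥` (the cube up to level `5r∥`, the corridor beyond).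
[cite: KozmaNitzan2024, §4 p. 26 (Q_v, H_{v,x})] -/
theorem mem_Q_union_Hfull_of_levS (h1 : -(5 * (P.r du.1 : ℤ)) ≤ PCells2S.lev P du y z) (h2 : PCells2S.lev P du y z ≤ 22 * (P.r du.1 : ℤ))
    (h3 : PCells2S.cenS P y (oth du.1) - 2 * (P.r (oth du.1) : ℤ) ≤ z (oth du.1))
    (h4 : z (oth du.1) ≤ PCells2S.cenS P y (oth du.1) + 2 * (P.r (oth du.1) : ℤ)) : z ∈ PCells2S.Q P y ∪ PCells2S.Hfull P y du := by
  have hr : (0 : ℤ) ≤ P.r (oth du.1) := by positivity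
  by_cases hc : PCells2S.lev P du y z ≤ 5 * (P.r du.1 : ℤ)
  · exact Finset.mem_union_left _ (P.mem_Q_of_levS h1 hc (by linarith) (by linarith))
  · push Not at hc
    exact Finset.mem_union_right _ (P.mem_Hfull_of_levS hc.le h2 h3 h4)

/-- **The unit box of `z` lies in the small arrival box `cenS (y+du) ± b₀`** from the level room `20r∥ − b₀∥ + 1 ≤ lev_y z ≤ 20r∥ + b₀∥ − 1` (along
`du`, about `cenS y`; `cenS (y+du)∥ = cenS y∥ + 20 r∥ σ`) and the transverse room `|z⊥ − cenS (y+du)⊥| ≤ b₀⊥ − 1` about the STAGGERED target centre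
(`cenS (y+du)⊥ = cenS y⊥ + σ c∥`, `PCells2S.cenS_add_stepVec_oth`). [cite: KozmaNitzan2024, §4 p. 26 (M_v), Lemma 11 (p. 22)] -/
theorem Icc_unit_subset_Mb_add_of_levS {b₀ : Fin 2 → ℕ} (h1 : 20 * (P.r du.1 : ℤ) - b₀ du.1 + 1 ≤ PCells2S.lev P du y z)
    (h2 : PCells2S.lev P du y z ≤ 20 * (P.r du.1 : ℤ) + b₀ du.1 - 1)
    (h3 : PCells2S.cenS P (y + stepVec du) (oth du.1) - b₀ (oth du.1) + 1 ≤ z (oth du.1))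
    (h4 : z (oth du.1) ≤ PCells2S.cenS P (y + stepVec du) (oth du.1) + b₀ (oth du.1) - 1) :
    Finset.Icc (z - 1) (z + 1) ⊆ PCells2S.Mb P b₀ (y + stepVec du) := by
  intro x hx
  rw [Finset.mem_Icc, Pi.le_def, Pi.le_def] at hx
  obtain ⟨hxl, hxu⟩ := hx
  rw [mem_Mb_iff]
  intro i
  by_cases hi : i = du.1
  · subst hi
    rw [lev_def] at h1 h2
    have hl := hxl du.1
    have hu := hxu du.1
    simp only [Pi.sub_apply, Pi.add_apply, Pi.one_apply] at hl hu
    rw [cenS_add_stepVec_fst]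
    rcases sgOf_sign du with hs | hs <;> rw [hs] at h1 h2 ⊢ <;> constructor <;> linarith
  · rw [eq_oth_of_ne hi]
    have hl := hxl (oth du.1)
    have hu := hxu (oth du.1)
    simp only [Pi.sub_apply, Pi.add_apply, Pi.one_apply] at hl hu
    constructor <;> linarith

/-- **The incoming arm of record misses the cube and the corridor of the target**: `BtwNS v δ ∩ (Q (v+δ) ∪ H_{v+δ,du}) = ∅` for `du ≠ rev δ`
(`H ⊆ Q ∪ FarNS`, `PCells2S.Q_add_disjoint_BtwNS`, `EwvNS_disjoint_FarNS`). [cite: KozmaNitzan2024, §4 p. 26 (E_{v,x}, H_{v,x})] -/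
theorem BtwNS_disjoint_Q_union_Hfull (v : Site 2) {δ du : MDir} (hdu : du ≠ rev δ) :
    Disjoint (P.BtwNS v δ) (PCells2S.Q P (v + stepVec δ) ∪ PCells2S.Hfull P (v + stepVec δ) du) := by
  refine Finset.disjoint_union_right.2 ⟨(P.Q_add_disjoint_BtwNS v δ).symm, ?_⟩
  refine Finset.disjoint_left.2 fun t ht htH => ?_
  rcases Finset.mem_union.1 (P.Hfull_subset_Q_union_FarNS _ du htH) with h | h
  · exact Finset.disjoint_left.1 (P.Q_add_disjoint_BtwNS v δ) h ht
  · exact Finset.disjoint_left.1 (P.EwvNS_disjoint_FarNS v hdu) (Finset.mem_union_left _ ht) h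

end PCells2S

namespace Skelφ

variable {V : Type} [DecidableEq V] {G : SimpleGraph V} [G.LocallyFinite] {ψ : V → Site 2}

section Rooms

variable {P : PCells2S} {w₀ : V} {Λ : ConcRadiiG} {b₀ : Fin 2 → ℕ} {α a' : ℕ} {e : Site 2 × MDir} {du : MDir}

/-! ## §2 `hreg`: a habitat vertex with footprint in `Q x ∪ H_{x,du}` -/

/-- **The footprint of a vertex of the fresh habitat lies in the probe world of record** `probeWorldNS v e.2 du = BtwNS v e.2 ∪ Q x ∪ H_{x,du}`.
[cite: KozmaNitzan2024, §4 p. 26 (E_{v,x}, H_{v,x})] -/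
theorem footprint_mem_probeWorldNS_of_mem_habΩS {v : V}
    (hv : v ∈ (cellGeomSG₂bS G ψ P w₀ Λ b₀).Ewv α e.1 e.2 ∪ (faceDataSGS G ψ P w₀ Λ).Hfull a' (tgt e) du) :
    ψ v ∈ P.probeWorldNS e.1 e.2 du := by
  rw [PCells2S.probeWorldNS]
  rcases Finset.mem_union.1 hv with hv | hv
  · rw [CellGeom.Ewv] at hv
    rcases Finset.mem_union.1 hv with hv | hv
    · change v ∈ VWin G ψ w₀ (P.BtwNS e.1 e.2) (Λ.rB α e.1 e.2) at hv
      exact Finset.mem_union_left _ (Finset.mem_union_left _ (φ_mem_of_mem_VWin hv))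
    · change v ∈ VWin G ψ w₀ (PCells2S.Q P (e.1 + stepVec e.2)) (Λ.rQ α (e.1 + stepVec e.2)) at hv
      exact Finset.mem_union_left _ (Finset.mem_union_right _ (φ_mem_of_mem_VWin hv))
  · change v ∈ VStair G ψ w₀ (PCells2S.Hfull P (tgt e) du) (profS P Λ a' (tgt e) du) at hv
    exact Finset.mem_union_right _ (mem_of_mem_VStair hv).1

/-- **A vertex of the fresh habitat with footprint in `Q x ∪ H_{x,du}` lies in the cube span `Q_α(x)` or in the corridor span** (the incoming arm
of record is planar-disjoint from both) — scheme `cellGeomSG₂bS`. [folklore] -/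
theorem mem_Q_or_Hfull_of_mem_habΩS (hdu : du ≠ rev e.2) {v : V}
    (hv : v ∈ (cellGeomSG₂bS G ψ P w₀ Λ b₀).Ewv α e.1 e.2 ∪ (faceDataSGS G ψ P w₀ Λ).Hfull a' (tgt e) du)
    (hψ : ψ v ∈ PCells2S.Q P (tgt e) ∪ PCells2S.Hfull P (tgt e) du) :
    v ∈ (cellGeomSG₂bS G ψ P w₀ Λ b₀).Q α (tgt e) ∨ v ∈ (faceDataSGS G ψ P w₀ Λ).Hfull a' (tgt e) du := by
  rcases Finset.mem_union.1 hv with hv | hv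
  · rw [CellGeom.Ewv] at hv
    rcases Finset.mem_union.1 hv with hv | hv
    · -- the arm of record: planar contradiction
      change v ∈ VWin G ψ w₀ (P.BtwNS e.1 e.2) (Λ.rB α e.1 e.2) at hv
      exact absurd hψ (Finset.disjoint_left.1 (P.BtwNS_disjoint_Q_union_Hfull e.1 hdu) (φ_mem_of_mem_VWin hv))
    · exact Or.inl hv
  · exact Or.inr hv

/-- **… hence in `Q_α(x) ∪ E^far_{a'}(x,du)`** (`StepsGeom.Hfull_subset`; `a'` an anchor level) — the form of `hreg` of `reachOblAtHNF_of_kgCorr`.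
[cite: KozmaNitzan2024, §4 p. 30 (Step IV)] -/
theorem mem_Q_union_Efar_of_mem_habΩS (hSt : StepsGeom (cellGeomSG₂bS G ψ P w₀ Λ b₀) (faceDataSGS G ψ P w₀ Λ))
    (ha' : a' ∈ (cellGeomSG₂bS G ψ P w₀ Λ b₀).anchSet α (tgt e)) (hdu : du ≠ rev e.2) {v : V}
    (hv : v ∈ (cellGeomSG₂bS G ψ P w₀ Λ b₀).Ewv α e.1 e.2 ∪ (faceDataSGS G ψ P w₀ Λ).Hfull a' (tgt e) du)
    (hψ : ψ v ∈ PCells2S.Q P (tgt e) ∪ PCells2S.Hfull P (tgt e) du) :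
    v ∈ (cellGeomSG₂bS G ψ P w₀ Λ b₀).Q α (tgt e) ∪ (cellGeomSG₂bS G ψ P w₀ Λ b₀).Efar a' (tgt e) du := by
  rcases mem_Q_or_Hfull_of_mem_habΩS hdu hv hψ with h | h
  · exact Finset.mem_union_left _ h
  · exact hSt.Hfull_subset _ _ _ _ ha' h

/-! ## §3 `hΩball`: the habitat membership device (weak steps) -/

/-- **A vertex whose footprint has a margin inside `Q_x ∪ H_{x,du}`, deep enough, lies in the cube span `Q_α(x)` or in the corridor span
`H^{a'}_{x,du}`** of the staggered scheme: by weak steps it has a neighbour, by `Lip` the neighbour's footprint is within one fine cell, and the two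
footprints lie together in `Q x` (levels `≤ 5r∥`) or together in `H_{x,du}` (levels `≥ 5r∥`). [cite: KozmaNitzan2024, §4 p. 26 ((29))] -/
theorem mem_Q_union_HfullSpanS (hlip : Lip G ψ) (hws : WeakSteps G ψ) {y : Site 2} {g : V} {Dg : ℕ} (hg : g ∈ graphBall G w₀ Dg)
    (hDQ : Dg + 1 ≤ Λ.rQ α y) (hDρ : ∀ ℓ, Dg + 1 ≤ Λ.ρ a' y du ℓ)
    (h1 : -(5 * (P.r du.1 : ℤ)) + 1 ≤ PCells2S.lev P du y (ψ g)) (h2 : PCells2S.lev P du y (ψ g) ≤ 22 * (P.r du.1 : ℤ) - 1)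
    (h3 : PCells2S.cenS P y (oth du.1) - 2 * (P.r (oth du.1) : ℤ) + 1 ≤ ψ g (oth du.1))
    (h4 : ψ g (oth du.1) ≤ PCells2S.cenS P y (oth du.1) + 2 * (P.r (oth du.1) : ℤ) - 1) :
    g ∈ (cellGeomSG₂bS G ψ P w₀ Λ b₀).Q α y ∪ (faceDataSGS G ψ P w₀ Λ).Hfull a' y du := by
  obtain ⟨g', hadj, -⟩ := hws g 0 1
  have hg' : g' ∈ graphBall G w₀ (Dg + 1) := mem_graphBall_succ_of_adj G hg hadj
  have hgD : g ∈ graphBall G w₀ (Dg + 1) := graphBall_mono G w₀ (Nat.le_succ _) hg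
  have hL := hlip hadj
  have hpar := abs_le.1 (hL du.1)
  have hperp := abs_le.1 (hL (oth du.1))
  have hr : (0 : ℤ) ≤ P.r (oth du.1) := by positivity
  -- the neighbour's level and transverse coordinate
  have hlev' : PCells2S.lev P du y (ψ g) - 1 ≤ PCells2S.lev P du y (ψ g') ∧ PCells2S.lev P du y (ψ g') ≤ PCells2S.lev P du y (ψ g) + 1 := by
    rw [PCells2S.lev_def, PCells2S.lev_def]
    rcases sgOf_sign du with hs | hs <;> rw [hs] <;> constructor <;> linarith
  have h3' : PCells2S.cenS P y (oth du.1) - 2 * (P.r (oth du.1) : ℤ) ≤ ψ g' (oth du.1) := by linarith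
  have h4' : ψ g' (oth du.1) ≤ PCells2S.cenS P y (oth du.1) + 2 * (P.r (oth du.1) : ℤ) := by linarith
  by_cases hc : PCells2S.lev P du y (ψ g) ≤ 5 * (P.r du.1 : ℤ) ∧ PCells2S.lev P du y (ψ g') ≤ 5 * (P.r du.1 : ℤ)
  · -- both footprints in the cube
    refine Finset.mem_union_left _ ?_
    have hgQ : ψ g ∈ PCells2S.Q P y := P.mem_Q_of_levS (by linarith) hc.1 (by linarith) (by linarith)
    have hg'Q : ψ g' ∈ PCells2S.Q P y := P.mem_Q_of_levS (by linarith [hlev'.1]) hc.2 (by linarith) (by linarith)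
    change g ∈ VWin G ψ w₀ (PCells2S.Q P y) (Λ.rQ α y)
    exact (mem_vspan_edgesIn_of_adj ((mem_Win G ψ).2 ⟨graphBall_mono G w₀ hDQ hgD, hgQ⟩)
      ((mem_Win G ψ).2 ⟨graphBall_mono G w₀ hDQ hg', hg'Q⟩) hadj).1
  · -- both footprints in the corridor
    refine Finset.mem_union_right _ ?_
    have hmin : 5 * (P.r du.1 : ℤ) ≤ PCells2S.lev P du y (ψ g) ∧ 5 * (P.r du.1 : ℤ) ≤ PCells2S.lev P du y (ψ g') := by
      rw [not_and_or] at hc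
      rcases hc with hc | hc <;> push Not at hc <;> constructor <;> linarith [hlev'.1, hlev'.2]
    have hgH : ψ g ∈ PCells2S.Hfull P y du := P.mem_Hfull_of_levS hmin.1 (by linarith) (by linarith) (by linarith)
    have hg'H : ψ g' ∈ PCells2S.Hfull P y du := P.mem_Hfull_of_levS hmin.2 (by linarith [hlev'.2]) h3' h4'
    change g ∈ VStair G ψ w₀ (PCells2S.Hfull P y du) (profS P Λ a' y du)
    refine (mem_vspan_edgesIn_of_adj ?_ ?_ hadj).1
    · exact mem_stair.2 ⟨hgH, graphBall_mono G w₀ (by unfold profS; exact hDρ _) hgD⟩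
    · exact mem_stair.2 ⟨hg'H, graphBall_mono G w₀ (by unfold profS; exact hDρ _) hg'⟩

/-- The cube span and the corridor span lie in the fresh habitat `E^{α}_{v,x} ∪ H^{a'}_{x,du}` (`x = tgt e`). [folklore] -/
theorem Q_union_HfullSpan_subset_habΩS :
    (cellGeomSG₂bS G ψ P w₀ Λ b₀).Q α (tgt e) ∪ (faceDataSGS G ψ P w₀ Λ).Hfull a' (tgt e) du ⊆
      (cellGeomSG₂bS G ψ P w₀ Λ b₀).Ewv α e.1 e.2 ∪ (faceDataSGS G ψ P w₀ Λ).Hfull a' (tgt e) du := by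
  intro g hg
  rcases Finset.mem_union.1 hg with hg | hg
  · exact Finset.mem_union_left _ (Finset.mem_union_right _ hg)
  · exact Finset.mem_union_right _ hg

/-- **`hΩball` in reading form**: a vertex of `B(w₀, D)` whose footprint has the margins of `mem_Q_union_HfullSpanS` about `cenS x` lies in the
fresh habitat (depth rows `D + 1 ≤ rQ α x`, `D + 1 ≤ ρ a' x du ℓ`). [cite: KozmaNitzan2024, §4 p. 26 ((29)), Lemma 12 (pp. 23–25)] -/
theorem mem_habΩS_of_footprint (hlip : Lip G ψ) (hws : WeakSteps G ψ) {g : V} {Dg : ℕ} (hg : g ∈ graphBall G w₀ Dg)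
    (hDQ : Dg + 1 ≤ Λ.rQ α (tgt e)) (hDρ : ∀ ℓ, Dg + 1 ≤ Λ.ρ a' (tgt e) du ℓ)
    (h1 : -(5 * (P.r du.1 : ℤ)) + 1 ≤ PCells2S.lev P du (tgt e) (ψ g)) (h2 : PCells2S.lev P du (tgt e) (ψ g) ≤ 22 * (P.r du.1 : ℤ) - 1)
    (h3 : PCells2S.cenS P (tgt e) (oth du.1) - 2 * (P.r (oth du.1) : ℤ) + 1 ≤ ψ g (oth du.1))
    (h4 : ψ g (oth du.1) ≤ PCells2S.cenS P (tgt e) (oth du.1) + 2 * (P.r (oth du.1) : ℤ) - 1) :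
    g ∈ (cellGeomSG₂bS G ψ P w₀ Λ b₀).Ewv α e.1 e.2 ∪ (faceDataSGS G ψ P w₀ Λ).Hfull a' (tgt e) du :=
  Q_union_HfullSpan_subset_habΩS (mem_Q_union_HfullSpanS hlip hws hg hDQ hDρ h1 h2 h3 h4)

/-! ## §4 `hM0` / `hlastM`: the small arrival boxes -/

/-- **The footprint of a vertex of `M_α(x)` lies in the small box `cenS x ± b₀`, the vertex in `B(w₀, rM α x)`** — the footprint form of `hM0`.
[folklore] -/
theorem footprint_mem_of_mem_MbS {x : Site 2} {v : V} (hv : v ∈ (cellGeomSG₂bS G ψ P w₀ Λ b₀).M α x) :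
    ψ v ∈ PCells2S.Mb P b₀ x ∧ v ∈ graphBall G w₀ (Λ.rM α x) := by
  rw [cellGeomSG₂bS_M] at hv
  exact ⟨φ_mem_of_mem_VWin hv, mem_graphBall_of_mem_VWin hv⟩

/-- **A vertex of the corridor span whose unit box lies in the small box `cenS (x+du) ± b₀` lies in `M_{a'}(x+du)`** (a span neighbour, `Lip`, and
the depth room `Λ.ρ a' x du ℓ + 1 ≤ Λ.rM a' (x+du)`). [cite: KozmaNitzan2024, §4 pp. 26–27] -/
theorem mem_Mb_of_mem_HfullS (hlip : Lip G ψ) {x : Site 2} (hρM : ∀ ℓ, Λ.ρ a' x du ℓ + 1 ≤ Λ.rM a' (x + stepVec du)) {v : V}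
    (hvH : v ∈ (faceDataSGS G ψ P w₀ Λ).Hfull a' x du) (hbox : Finset.Icc (ψ v - 1) (ψ v + 1) ⊆ PCells2S.Mb P b₀ (x + stepVec du)) :
    v ∈ (cellGeomSG₂bS G ψ P w₀ Λ b₀).M a' (x + stepVec du) := by
  have hvM0 : ψ v ∈ PCells2S.Mb P b₀ (x + stepVec du) := hbox (Finset.mem_Icc.2 ⟨fun i => by simp, fun i => by simp⟩)
  change v ∈ VStair G ψ w₀ (PCells2S.Hfull P x du) (profS P Λ a' x du) at hvH
  rw [cellGeomSG₂bS_M]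
  obtain ⟨z, hz, hvz⟩ := exists_adj_of_mem_VStair hvH
  obtain ⟨-, hdv⟩ := mem_of_mem_VStair hvH
  obtain ⟨-, hdz⟩ := mem_of_mem_VStair hz
  have hψz : ψ z ∈ PCells2S.Mb P b₀ (x + stepVec du) := by
    refine hbox (Finset.mem_Icc.2 ⟨fun i => ?_, fun i => ?_⟩)
    · have := (abs_le.1 (hlip hvz i)).2; simp only [Pi.sub_apply, Pi.one_apply]; linarith
    · have := (abs_le.1 (hlip hvz i)).1; simp only [Pi.add_apply, Pi.one_apply]; linarith
  have hvW : v ∈ Win G ψ w₀ (PCells2S.Mb P b₀ (x + stepVec du)) (Λ.rM a' (x + stepVec du)) :=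
    (mem_Win G ψ).2 ⟨graphBall_mono G w₀ (by unfold profS; exact (Nat.le_succ _).trans (hρM _)) hdv, hvM0⟩
  have hzW : z ∈ Win G ψ w₀ (PCells2S.Mb P b₀ (x + stepVec du)) (Λ.rM a' (x + stepVec du)) :=
    (mem_Win G ψ).2 ⟨graphBall_mono G w₀ (by unfold profS; exact (Nat.le_succ _).trans (hρM _)) hdz, hψz⟩
  exact (mem_vspan_edgesIn_of_adj hvW hzW hvz).1

/-- **A vertex of the fresh habitat with footprint in `H_{x,du}` whose unit box lies in `cenS (x+du) ± b₀` (`b₀ ≤ 3r`) lies in `M_{a'}(x+du)`** —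
the form of `hlastM` of `reachOblAtHNF_of_kgCorr` at the staggered scheme (the cube alternative is planar-impossible: `Q x ∩ Q (x+du) = ∅`).
[cite: KozmaNitzan2024, §4 pp. 26–27] -/
theorem mem_Mb_of_mem_habΩS (hlip : Lip G ψ) (hdu : du ≠ rev e.2) (hρM : ∀ ℓ, Λ.ρ a' (tgt e) du ℓ + 1 ≤ Λ.rM a' (tgt e + stepVec du))
    (hb : ∀ i, b₀ i ≤ 3 * P.r i) {v : V}
    (hv : v ∈ (cellGeomSG₂bS G ψ P w₀ Λ b₀).Ewv α e.1 e.2 ∪ (faceDataSGS G ψ P w₀ Λ).Hfull a' (tgt e) du)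
    (hH : ψ v ∈ PCells2S.Hfull P (tgt e) du) (hbox : Finset.Icc (ψ v - 1) (ψ v + 1) ⊆ PCells2S.Mb P b₀ (tgt e + stepVec du)) :
    v ∈ (cellGeomSG₂bS G ψ P w₀ Λ b₀).M a' (tgt e + stepVec du) := by
  rcases mem_Q_or_Hfull_of_mem_habΩS hdu hv (Finset.mem_union_right _ hH) with hvQ | hvHs
  · -- footprint in `Q x` and in `cenS (x+du) ± b₀ ⊆ M (x+du) ⊆ Q (x+du)`: impossible
    have hvM0 : ψ v ∈ PCells2S.Mb P b₀ (tgt e + stepVec du) := hbox (Finset.mem_Icc.2 ⟨fun i => by simp, fun i => by simp⟩)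
    have h1 : ψ v ∈ PCells2S.Q P (tgt e) := by
      change v ∈ VWin G ψ w₀ (PCells2S.Q P (tgt e)) (Λ.rQ α (tgt e)) at hvQ; exact φ_mem_of_mem_VWin hvQ
    have h2 : ψ v ∈ PCells2S.Q P (tgt e + stepVec du) := P.M_subset_Q _ (P.Mb_subset_M hb _ hvM0)
    exact absurd h2 (Finset.disjoint_left.1 (P.Q_disjoint_Q_add (tgt e) du) h1)
  · exact mem_Mb_of_mem_HfullS hlip hρM hvHs hbox

end Rooms

/-! ## §5 `hdeep` from validity: explored neighbours of the fresh world are deep -/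

section Deep

variable {P : PCells2S} {w₀ : V} {Λ : ConcRadiiG} {b₀ : Fin 2 → ℕ}

/-- **Every explored vertex adjacent to the fresh world is `R₀`-deep**, for a VALID history of the oriented lag-1 scheme over the staggered cells:
the explored region lies in the cover by cells and stub zones (at the arrival anchors) of determined macro-vertices other than the target `x` and
`x + du` (`Valid₂O.cover`); off the lineage those are ℓ^∞-gap-2 separated from the probe world of record, which carries the footprints of the fresh
world, so `Lip` forbids the edge; on the lineage `u = v` the windows have radii `rC α v`, `rB α v δ′` (`α = aOf₁O h e`) — the form of `hdeep` of
`Skelφ.real_rim_le_corrO`. [cite: KozmaNitzan2024, §4 pp. 26–27 ((29), (31)), p. 31] -/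
theorem deep_of_valid₂OS (hlip : Lip G ψ) {S : KSchA V ℕ} (hΓ : S.Γ = cellGeomSG₂bS G ψ P w₀ Λ b₀) {h : ProbeHistory V} {e : Site 2 × MDir}
    (hV : S.Valid₂O G h e) {du : MDir} (hdu : du ∈ S.onwardO G h (tgt e)) (a' : ℕ) {R₀ : ℕ}
    (hRC : Λ.rC (S.aOf₁O G h e) e.1 ≤ R₀) (hRB : ∀ δ', Λ.rB (S.aOf₁O G h e) e.1 δ' ≤ R₀) :
    ∀ a ∈ S.Vx G h, ∀ b ∈ S.Γ.Ewv (S.aOf₁O G h e) e.1 e.2 ∪ (faceDataSGS G ψ P w₀ Λ).Hfull a' (tgt e) du,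
      b ∉ S.Vx G h → G.Adj a b → a ∈ graphBall G w₀ R₀ := by
  intro a ha b hb _ hadj
  obtain ⟨det, hxdet, hydet, hcov⟩ := hV.cover
  -- the footprint of `b`: the probe world of record
  have hb2 : ψ b ∈ P.probeWorldNS e.1 e.2 du := by
    rw [hΓ] at hb; exact footprint_mem_probeWorldNS_of_mem_habΩS hb
  -- `x + du ≠ v`: the source column is explored, the column of `x + du` is not
  have hyv : e.1 + stepVec e.2 + stepVec du ≠ e.1 := by
    intro hh
    obtain ⟨y, hy, hyc⟩ := hV.src_mem
    have hon : du ∈ S.onward G h (tgt e) := ((KSchA.mem_onwardO G S).1 hdu).1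
    rw [KSchA.onward, Finset.mem_filter] at hon
    exact hon.2 y hy (by rw [show tgt e + stepVec du = e.1 by exact hh]; exact hyc)
  -- `a` lies in the cover
  have ha' := hcov (Finset.mem_coe.2 ha)
  rw [CellGeom.Cover, Set.mem_iUnion₂] at ha'
  obtain ⟨u, hu, hau⟩ := ha'
  have hux : u ≠ tgt e := fun hh => hxdet (hh ▸ hu)
  have huy : u ≠ tgt e + stepVec du := fun hh => hydet du hdu (hh ▸ hu)
  by_cases huv : u = e.1
  · -- ON THE LINEAGE: the window radii
    subst huv
    rcases hau with hau | hau
    · rw [hΓ] at hau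
      change a ∈ VWin G ψ w₀ (PCells2S.Cell P e.1) (Λ.rC (S.aOf₁O G h e) e.1) at hau
      exact graphBall_mono G w₀ hRC (mem_graphBall_of_mem_VWin hau)
    · rw [Set.mem_iUnion] at hau
      obtain ⟨δ', hau⟩ := hau
      rw [hΓ] at hau
      change a ∈ VWin G ψ w₀ (PCells2S.Zone P e.1 δ') (Λ.rB (S.aOf₁O G h e) e.1 δ') at hau
      exact graphBall_mono G w₀ (hRB δ') (mem_graphBall_of_mem_VWin hau)
  · -- OFF THE LINEAGE: planar ℓ^∞-gap-2 separation forbids the edge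
    exfalso
    rcases hau with hau | hau
    · rw [hΓ] at hau
      change a ∈ VWin G ψ w₀ (PCells2S.Cell P u) (Λ.rC _ u) at hau
      exact (ne_not_adj_of_sepInf hlip (P.Cell_sepInf_probeWorldNS huv hux huy) (φ_mem_of_mem_VWin hau) hb2).2 hadj
    · rw [Set.mem_iUnion] at hau
      obtain ⟨δ', hau⟩ := hau
      rw [hΓ] at hau
      change a ∈ VWin G ψ w₀ (PCells2S.Zone P u δ') (Λ.rB _ u δ') at hau
      exact (ne_not_adj_of_sepInf hlip (P.Zone_sepInf_probeWorldNS huv hux huy δ') (φ_mem_of_mem_VWin hau) hb2).2 hadj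

end Deep

/-! ## §6 The arrival cube's fine footprint about the frame-change vertex (`hM0f`) -/

section Footprint

variable {P : PCells2S} {w₀ : V} {Λ : ConcRadiiG} {b₀ : Fin 2 → ℕ} {α : ℕ}

/-- **`hM0f` of `reachChainF_of_kgCorr_fine` at the staggered scheme**: a vertex of `M_α(x)` has footprint within `b₀ i` of the frame-change vertex's
footprint `ψ c₀ = cenS x`, coordinatewise (`mem_Mb_iff`; so `K₀ := b₀ 0`, `K₁ := b₀ 1`). [cite: KozmaNitzan2024, §4 p. 26 (M_v), Lemma 12 (p. 24)] -/
theorem footprint_sub_le_of_mem_MbS {x : Site 2} {u c₀ : V} (hu : u ∈ (cellGeomSG₂bS G ψ P w₀ Λ b₀).M α x) (hc₀ : ψ c₀ = P.cenS x) (i : Fin 2) :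
    |ψ u i - ψ c₀ i| ≤ b₀ i := by
  have h := (PCells2S.mem_Mb_iff P).1 (footprint_mem_of_mem_MbS hu).1 i
  rw [hc₀, abs_le]
  constructor <;> linarith [h.1, h.2]

/-- The two-coordinate form `hM0f` reads. [folklore] -/
theorem footprint_sub_le_of_mem_MbS₂ {x : Site 2} {c₀ : V} (hc₀ : ψ c₀ = P.cenS x) :
    ∀ u ∈ (cellGeomSG₂bS G ψ P w₀ Λ b₀).M α x, |ψ u 0 - ψ c₀ 0| ≤ b₀ 0 ∧ |ψ u 1 - ψ c₀ 1| ≤ b₀ 1 :=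
  fun _ hu => ⟨footprint_sub_le_of_mem_MbS hu hc₀ 0, footprint_sub_le_of_mem_MbS hu hc₀ 1⟩

end Footprint

end Skelφ

end Transplant

end Summit.CriticalPhenomena.PercolationContinuityZ3.Theorems

end
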